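import Literature.Analysis.FluidPDE.HardSphereCollisionRecord
import Literature.Analysis.FluidPDE.HardSphereFlowMeasurable
import HarnessLib

/-!
# Collision sums are measurable in the initial datum

For a hard-sphere flow `Φ : HardSphereFlow G ε N` (`Literature.Analysis.FluidPDE.HardSphereFlow`,
Alexander's flow as a hypothesis structure: time-slice measurability `Φ.measurable_flow t` and
hard-sphere trajectories on the good set, nothing more) and the collision sums / empirical
collision measure of `Literature.Analysis.FluidPDE.HardSphereCollisionRecord`
(`collisionSum`, `HardSphereFlow.collisionSum`, `HardSphereFlow.empiricalCollisionMeasure`),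
this file proves that for every continuous (and measurable) test function `f` the collision
functional of the initial datum

`z ↦ ∫ f d(Φ.empiricalCollisionMeasure (Icc a b) z) = Σ_{collisions of the orbit of z in [a, b]} Σ_{ordered contact pairs (i, j)} f (t, x_i, ω, v_i⁻, v_j⁻)`

is MEASURABLE once extended by `0` off the good set, hence a.e.-measurable under every law
carried by the good set (`HardSphereFlow.measurable_indicator_integral_empiricalCollisionMeasure`,
`HardSphereFlow.aemeasurable_integral_empiricalCollisionMeasure`, and the `collisionSum` forms
`measurable_indicator_collisionSum_Icc/Ioc` for sums with values in a metrizable Borel additive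
monoid, e.g. `ℝ`, `ℝ≥0∞`, `ℝ^d`). This is the measurability deliberately left open in
`HardSphereCollisionRecord` and `CollisionalTransfer`; it is what makes events such as
`{z | η < |K_N[F](z)|}` of route statements about collision statistics measurable. Hypotheses:
a hard-sphere regular and measurable geometry (`Geometry.IsHardSphereRegular`,
`Geometry.IsMeasurable`: `ℝ^d`, and `T^d` with `ε < 1/2`); NO joint measurability of
`(t, z) ↦ Φ_t z` is assumed.

## The argument (velocity-jump detection)

Along a hard-sphere trajectory velocities are piecewise constant and a particle's velocity
jumps exactly at the collisions it takes part in (the incoming normal relative velocity is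
nonzero, `IsHardSphereTrajectory.vel_ne_collidePair_iff`). Chop `(a, b]` into the `2^n` dyadic
cells `(t_k, t_{k+1}]` and let the rank-`n` approximant be

`collisionSumApprox … n = Σ_k Σ_{i ≠ j, v_i(t_{k+1}) ≠ v_i(t_k), v_j(t_{k+1}) ≠ v_j(t_k)} f (t_{k+1}, x_i(t_{k+1}), ε⁻¹(x_i(t_{k+1}) - x_j(t_{k+1})), v_i(t_k), v_j(t_k))`

(`jumpSum`, `cellMark`): it only evaluates the flow at the fixed mesh times, so it is measurable
in `z` (`HardSphereFlow.measurable_collisionSumApprox`). For `n` large the finitely many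
collision times of the orbit in `(a, b]` lie in distinct cells (`eventually_fine`); then a cell
detects exactly the two ordered pairs of its collision, with the EXACT pre-collisional
velocities `v(t_k)` (`IsHardSphereTrajectory.jumpSum_eq`, `collidePair_vel_eq`), while time,
position and impact direction read at `t_{k+1}` converge to the collision mark as `n → ∞`
(continuity of positions and local linearity of the separation vector along the free flight
after the collision, `Geometry.IsHardSphereRegular.eventually_sepVec_freeFlight`;
`tendsto_cellMark`). Hence `collisionSumApprox … n → collisionSum … (Ioc a b) (f ∘ mark)` on
the good set (`IsHardSphereTrajectory.tendsto_collisionSumApprox`), and a pointwise limit of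
measurable maps into a metrizable space is measurable (`measurable_of_tendsto_metrizable`). The
closed window `[a, b]` adds the (directly measurable) contribution of a collision at time `a`
(`collisionPairSum_singleton`, `IsHardSphereTrajectory.collisionPairSum_Icc`,
`HardSphereFlow.measurable_sum_contactPairs`).

## Mathlib / Literature reuse

The velocity-sampling device is the one of
`Literature.MathematicalPhysics.KineticTheory.BackwardClusterMeasurable` (measurability of
backward clusters, where only the colliding PAIRS are read off; here the marks are reconstructed
as well, which needs the convergence `tendsto_cellMark`); that file lives above `FluidPDE` and is
not imported. `measurable_of_tendsto_metrizable`, `Finset.measurable_sum`, `Measurable.ite`,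
`measurableSet_eq_fun`, `Measurable.inner`, `tendsto_finsetSum`, `Finset.sum_fiberwise_of_maps_to`,
`Nat.ceil`, `tendsto_pow_atTop_nhds_zero_of_lt_one` are Mathlib's. The trajectory kit
(`IsHardSphereTrajectory.free/binary/pos_continuous`, `tendsto_collidePair`,
`isIncoming_collidePair`, `contactPairs_eq_pair`, `collisionSum_eq_finset_sum`,
`collisionPairSum_union`, `HardSphereFlow.integral_empiricalCollisionMeasure`,
`Geometry.IsMeasurable.measurable_sepVec_config`, `measurableSet_contactSet`) is
`HardSphereDynamics(Proofs)` / `HardSphereRegularGeometry` / `HardSphereCollisionRecord` /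
`HardSphereFlowMeasurable`. Mathlib has no hard-sphere dynamics; its parametric-integral
measurability (`StronglyMeasurable.integral_prod_right`, kernels) concerns a FIXED measure or a
measurable kernel, which is what is being established here.

## Design choices

* The approximants are honest definitions (`cellMark`, `jumpSum`, `meshPt`, `cellIndex`,
  `collisionSumApprox`) rather than proof-local terms: the convergence theorem
  `IsHardSphereTrajectory.tendsto_collisionSumApprox` is a reusable statement about one
  trajectory (a Riemann-type reconstruction of collision sums from finitely many time slices).
* Test functions are assumed continuous AND measurable (`Continuous f`, `Measurable f`): the
  second follows from the first on `ℝ^d`/`T^d` (`Continuous.measurable`), but keeping it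
  explicit avoids any Borel-compatibility hypothesis on the abstract position space `X`.
* Results are stated with `Set.indicator Φ.good` (the flow is junk off the good set) and as
  `AEMeasurable` under laws with `μ Φ.goodᶜ = 0` (the Liouville measure,
  `HardSphereFlow.measure_compl_good`, and every law absolutely continuous with respect to it).
* Deliberately NOT here: measurability for merely measurable bounded `f` (would follow by a
  monotone-class argument from the continuous case), measurability of individual collision
  times / records in `z`, and joint measurability of the flow.

## References

* I. Gallagher, L. Saint-Raymond, B. Texier, *From Newton to Boltzmann* (2013), §4.1,
  Prop. 4.1.1, Def. 4.1.2 (hard-sphere trajectories: finitely many, binary, non-grazing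
  collisions almost surely).
* M. Pulvirenti, S. Simonella, *On the evolution of the empirical measure for the hard-sphere
  dynamics*, arXiv:1504.03215 (2015), §3 (collision sums along one trajectory).
-/

open Set Filter Function
open _root_.MeasureTheory _root_.Topology
open scoped ENNReal Topology InnerProductSpace

namespace Literature.Analysis.FluidPDE

noncomputable section

section Kinetic

variable {d : Type*} [Fintype d] {X : Type*} {N : ℕ}

/-! ## Velocity-jump detection over a time cell -/

/-- The mark read off a curve `γ` over the cell `(l, r]` for the ordered pair `(i, j)`:
time `r`, position `x_i(r)`, direction `ε⁻¹ (x_i(r) - x_j(r))`, velocities `(v_i(l), v_j(l))`.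
On a fine cell around a collision of `(i, j)` the velocities are the exact pre-collisional ones
and the other components approximate the collision mark. [folklore] -/
def cellMark (G : Geometry d X) (ε : ℝ) (γ : ℝ → Config N d X) (l r : ℝ) (i j : Fin N) :
    ℝ × X × EuclideanSpace ℝ d × EuclideanSpace ℝ d × EuclideanSpace ℝ d :=
  (r, (γ r i).1, ε⁻¹ • G.sepVec (γ r i).1 (γ r j).1, (γ l i).2, (γ l j).2)

/-- The **velocity-jump sum** of `f` over the cell `(l, r]`: the sum of `f (cellMark …)` over the
ordered pairs `i ≠ j` of particles BOTH of whose velocities differ at times `l` and `r`. Along a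
hard-sphere trajectory velocities are piecewise constant and jump exactly at the collisions a
particle takes part in, so on a cell containing a single collision this detects its two ordered
pairs (`IsHardSphereTrajectory.jumpSum_eq`). Only point evaluations of `γ` enter, which makes the
flow version measurable in the initial datum. [folklore] -/
def jumpSum {M : Type*} [AddCommMonoid M] (G : Geometry d X) (ε : ℝ) (γ : ℝ → Config N d X)
    (f : ℝ × X × EuclideanSpace ℝ d × EuclideanSpace ℝ d × EuclideanSpace ℝ d → M)
    (l r : ℝ) : M :=
  ∑ i, ∑ j, if i ≠ j ∧ (γ r i).2 ≠ (γ l i).2 ∧ (γ r j).2 ≠ (γ l j).2 then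
    f (cellMark G ε γ l r i j) else 0

/-- The `k`-th point `a + k (b - a) / 2^n` of the dyadic mesh of rank `n` of `[a, b]`. [folklore] -/
def meshPt (a b : ℝ) (n k : ℕ) : ℝ := a + k * ((b - a) / 2 ^ n)

/-- The **dyadic velocity-jump approximation** of rank `n` of the collision sum of `f` over the
window `(a, b]`: the sum of the velocity-jump sums over the `2^n` cells
`(a + k (b-a)/2^n, a + (k+1) (b-a)/2^n]`. It converges to the collision sum
`collisionSum G ε γ (Ioc a b) (f ∘ mark)` along every hard-sphere trajectory
(`IsHardSphereTrajectory.tendsto_collisionSumApprox`). [folklore] -/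
def collisionSumApprox {M : Type*} [AddCommMonoid M] (G : Geometry d X) (ε : ℝ)
    (γ : ℝ → Config N d X)
    (f : ℝ × X × EuclideanSpace ℝ d × EuclideanSpace ℝ d × EuclideanSpace ℝ d → M)
    (a b : ℝ) (n : ℕ) : M :=
  ∑ k ∈ Finset.range (2 ^ n), jumpSum G ε γ f (meshPt a b n k) (meshPt a b n (k + 1))

section Mesh

variable {a b : ℝ}

/-- The mesh starts at `a`. [folklore] -/
@[simp]
theorem meshPt_zero (a b : ℝ) (n : ℕ) : meshPt a b n 0 = a := by simp [meshPt]

/-- Consecutive mesh points differ by the mesh size `(b - a) / 2^n`. [folklore] -/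
theorem meshPt_succ (a b : ℝ) (n k : ℕ) :
    meshPt a b n (k + 1) = meshPt a b n k + (b - a) / 2 ^ n := by
  simp only [meshPt, Nat.cast_add, Nat.cast_one]
  ring

/-- The mesh ends at `b`. [folklore] -/
@[simp]
theorem meshPt_two_pow (a b : ℝ) (n : ℕ) : meshPt a b n (2 ^ n) = b := by
  simp only [meshPt, Nat.cast_pow, Nat.cast_ofNat]
  field_simp
  ring

/-- The mesh is monotone for `a ≤ b`. [folklore] -/
theorem meshPt_mono (hab : a ≤ b) (n : ℕ) : Monotone (meshPt a b n) := fun k k' hkk' => by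
  simp only [meshPt]
  have h : (0 : ℝ) ≤ (b - a) / 2 ^ n := div_nonneg (sub_nonneg.2 hab) (by positivity)
  nlinarith [show (k : ℝ) ≤ k' from Nat.cast_le.2 hkk']

/-- Mesh points lie in `[a, b]`. [folklore] -/
theorem meshPt_mem_Icc (hab : a ≤ b) {n k : ℕ} (hk : k ≤ 2 ^ n) :
    meshPt a b n k ∈ Icc a b :=
  ⟨by simpa using meshPt_mono hab n (Nat.zero_le k), by simpa using meshPt_mono hab n hk⟩

/-- The index of the cell `(meshPt k, meshPt (k+1)]` containing a time `s ∈ (a, b]`. [folklore] -/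
def cellIndex (a b : ℝ) (n : ℕ) (s : ℝ) : ℕ := ⌈(s - a) / ((b - a) / 2 ^ n)⌉₊ - 1

/-- A time `s ∈ (a, b]` lies in the cell of its index, and that index is `< 2^n`. [folklore] -/
theorem mem_cell_cellIndex (hab : a < b) (n : ℕ) {s : ℝ} (hs : s ∈ Ioc a b) :
    cellIndex a b n s < 2 ^ n ∧
      s ∈ Ioc (meshPt a b n (cellIndex a b n s)) (meshPt a b n (cellIndex a b n s + 1)) := by
  set h := (b - a) / 2 ^ n with hh
  have hpos : 0 < h := div_pos (sub_pos.2 hab) (by positivity)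
  set x := (s - a) / h with hx
  have hx0 : 0 < x := div_pos (sub_pos.2 hs.1) hpos
  have hxle : x ≤ 2 ^ n := by
    rw [hx, div_le_iff₀ hpos, hh, mul_div_cancel₀ _ (by positivity : (2 : ℝ) ^ n ≠ 0)]
    linarith [hs.2]
  have hceil_pos : 0 < ⌈x⌉₊ := Nat.ceil_pos.2 hx0
  have hk : (cellIndex a b n s : ℝ) = ⌈x⌉₊ - 1 := by
    rw [cellIndex, ← hh, ← hx, Nat.cast_sub hceil_pos, Nat.cast_one]
  have hsx : s = a + x * h := by rw [hx, div_mul_cancel₀ _ hpos.ne']; ring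
  refine ⟨?_, ?_, ?_⟩
  · have : ⌈x⌉₊ ≤ 2 ^ n := Nat.ceil_le.2 (by exact_mod_cast hxle)
    rw [cellIndex, ← hh, ← hx]
    omega
  · show a + (cellIndex a b n s : ℝ) * h < s
    rw [hk, hsx]
    have := Nat.ceil_lt_add_one hx0.le
    nlinarith
  · show s ≤ a + ((cellIndex a b n s + 1 : ℕ) : ℝ) * h
    rw [Nat.cast_add, Nat.cast_one, hk, sub_add_cancel, hsx]
    nlinarith [Nat.le_ceil x]

/-- Cells are disjoint: a time in the cell `(meshPt k, meshPt (k+1)]` has index `k`. [folklore] -/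
theorem cellIndex_eq_of_mem (hab : a < b) {n k : ℕ} {s : ℝ}
    (hs : s ∈ Ioc (meshPt a b n k) (meshPt a b n (k + 1))) : cellIndex a b n s = k := by
  set h := (b - a) / 2 ^ n with hh
  have hpos : 0 < h := div_pos (sub_pos.2 hab) (by positivity)
  have h1 : (k : ℝ) < (s - a) / h := by
    rw [lt_div_iff₀ hpos]
    have := hs.1
    simp only [meshPt] at this
    linarith
  have h2 : (s - a) / h ≤ k + 1 := by
    rw [div_le_iff₀ hpos]
    have := hs.2
    simp only [meshPt, Nat.cast_add, Nat.cast_one] at this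
    linarith
  have hceil : ⌈(s - a) / h⌉₊ = k + 1 := by
    refine le_antisymm (Nat.ceil_le.2 (by exact_mod_cast h2)) ?_
    exact Nat.add_one_le_iff.2 (Nat.lt_ceil.2 h1)
  rw [cellIndex, ← hh, hceil, Nat.add_sub_cancel]

/-- Two times in the same cell are closer than the mesh size. [folklore] -/
theorem sub_lt_of_mem_cell {n k : ℕ} {s s' : ℝ}
    (hs : s ∈ Ioc (meshPt a b n k) (meshPt a b n (k + 1)))
    (hs' : s' ∈ Ioc (meshPt a b n k) (meshPt a b n (k + 1))) : |s - s'| < (b - a) / 2 ^ n := by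
  rw [meshPt_succ] at hs hs'
  rw [abs_sub_lt_iff]
  constructor <;> linarith [hs.1, hs.2, hs'.1, hs'.2]

/-- The mesh size tends to `0`. [folklore] -/
theorem tendsto_meshSize (a b : ℝ) : Tendsto (fun n : ℕ => (b - a) / 2 ^ n) atTop (𝓝 0) := by
  have h : Tendsto (fun n : ℕ => ((2 : ℝ) ^ n)⁻¹) atTop (𝓝 0) := by
    simpa only [← inv_pow] using tendsto_pow_atTop_nhds_zero_of_lt_one (by norm_num) (by norm_num)
  simpa [div_eq_mul_inv] using h.const_mul (b - a)

end Mesh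

/-! ## The velocity-jump sum on a cell with at most one collision -/

section JumpSum

variable {M : Type*} [AddCommMonoid M] {G : Geometry d X} {ε : ℝ} {γ : ℝ → Config N d X}
  {f : ℝ × X × EuclideanSpace ℝ d × EuclideanSpace ℝ d × EuclideanSpace ℝ d → M}

/-- Unfolding lemma for `jumpSum`. [folklore] -/
theorem jumpSum_def (G : Geometry d X) (ε : ℝ) (γ : ℝ → Config N d X)
    (f : ℝ × X × EuclideanSpace ℝ d × EuclideanSpace ℝ d × EuclideanSpace ℝ d → M)
    (l r : ℝ) :
    jumpSum G ε γ f l r = ∑ i, ∑ j,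
      if i ≠ j ∧ (γ r i).2 ≠ (γ l i).2 ∧ (γ r j).2 ≠ (γ l j).2 then
        f (cellMark G ε γ l r i j) else 0 :=
  rfl

/-- If no velocity differs between the endpoints of the cell, the velocity-jump sum vanishes.
[folklore] -/
theorem jumpSum_eq_zero_of_forall_eq {l r : ℝ} (hv : ∀ k, (γ r k).2 = (γ l k).2) :
    jumpSum G ε γ f l r = 0 := by
  refine Finset.sum_eq_zero fun i _ => Finset.sum_eq_zero fun j _ => ?_
  rw [if_neg]
  exact fun hc => hc.2.1 (hv i)

/-- A double sum of an indicator of a finset of pairs is the sum over that finset. [folklore] -/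
theorem sum_sum_ite_mem_eq {S : Finset (Fin N × Fin N)} (g : Fin N → Fin N → M)
    [DecidablePred (· ∈ S)] :
    (∑ i, ∑ j, if (i, j) ∈ S then g i j else 0) = ∑ p ∈ S, g p.1 p.2 := by
  classical
  rw [← Fintype.sum_prod_type' fun i j => if (i, j) ∈ S then g i j else 0]
  simp only [Prod.mk.eta]
  rw [← Finset.sum_filter, Finset.filter_mem_eq_inter, Finset.univ_inter]

end JumpSum

namespace IsHardSphereTrajectory

variable [TopologicalSpace X] {G : Geometry d X} {ε : ℝ} {γ : ℝ → Config N d X}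

/-- On a window `[s, t]` whose interior-and-right part `(s, t]` is collision-free, velocities do
not change (local copy of `BackwardClusterMeasurable`'s `vel_eq_of_free`, which lives above
`FluidPDE` and is not imported). [folklore] -/
private theorem vel_eq_of_forall_notMem_Ioc (h : IsHardSphereTrajectory G ε N γ) {s t : ℝ}
    (hst : s ≤ t)
    (hfree : ∀ τ ∈ Ioc s t, τ ∉ collisionTimes G ε γ) (k : Fin N) :
    (γ t k).2 = (γ s k).2 := by
  rw [h.free s t hst hfree, freeFlight_apply]

/-- **Velocities jump exactly at participations.** At a collision time `s` of the ordered pair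
`(p, q)`, with pre-collisional configuration `z⁻ = collidePair G p q (γ s)`
(`tendsto_collidePair`): the velocity of `k` at `s` differs from its pre-collisional value iff
`k ∈ {p, q}` (the incoming normal component is nonzero, `isIncoming_collidePair`). [folklore] -/
theorem vel_ne_collidePair_iff (h : IsHardSphereTrajectory G ε N γ) {s : ℝ} {p q : Fin N}
    (hpq : p ≠ q) (hc : γ s ∈ contactSet G N ε p q) (k : Fin N) :
    (γ s k).2 ≠ (collidePair G p q (γ s) k).2 ↔ k = p ∨ k = q := by
  set zpre := collidePair G p q (γ s) with hzpre
  have hin : IsIncoming G zpre p q := h.isIncoming_collidePair hpq hc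
  have heq : γ s = collidePair G p q zpre := (collidePair_collidePair hpq (γ s)).symm
  set n := G.sepVec (zpre p).1 (zpre q).1 with hn
  have hinner : ⟪(zpre p).2 - (zpre q).2, n⟫_ℝ ≠ 0 := by
    rw [real_inner_comm]
    exact (ne_of_lt hin)
  have hn0 : n ≠ 0 := fun h0 => hinner (by rw [h0, inner_zero_right])
  have hcoef : ⟪(zpre p).2 - (zpre q).2, n⟫_ℝ / ‖n‖ ^ 2 ≠ 0 :=
    div_ne_zero hinner (pow_ne_zero 2 (norm_ne_zero_iff.2 hn0))
  have hsmul : (⟪(zpre p).2 - (zpre q).2, n⟫_ℝ / ‖n‖ ^ 2) • n ≠ 0 :=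
    smul_ne_zero hcoef hn0
  constructor
  · intro hk
    by_contra hnot
    obtain ⟨hkp, hkq⟩ := not_or.1 hnot
    apply hk
    conv_lhs => rw [heq]
    rw [collidePair_apply_of_ne hkp hkq]
  · rintro (rfl | rfl)
    · conv_lhs => rw [heq, collidePair_apply_left hpq]
      change (reflectVel n ((zpre k).2, (zpre q).2)).1 ≠ (zpre k).2
      simp only [reflectVel]
      intro hbad
      exact hsmul (by simpa using hbad)
    · conv_lhs => rw [heq, collidePair_apply_right]
      change (reflectVel n ((zpre p).2, (zpre k).2)).2 ≠ (zpre k).2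
      simp only [reflectVel]
      intro hbad
      exact hsmul (by simpa using hbad)

/-- **Pre-collisional velocities are the velocities just before.** If `(p, q)` is in contact
at time `s` and `(l, s)` is collision-free (`l < s`), the pre-collisional configuration
`collidePair G p q (γ s)` has the velocities of `γ l`. [folklore] -/
theorem collidePair_vel_eq (h : IsHardSphereTrajectory G ε N γ) {l s : ℝ} (hls : l < s)
    (hfree : ∀ τ ∈ Ioo l s, τ ∉ collisionTimes G ε γ) {p q : Fin N} (hpq : p ≠ q)
    (hc : γ s ∈ contactSet G N ε p q) (k : Fin N) :
    (collidePair G p q (γ s) k).2 = (γ l k).2 := by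
  have hlt : ∀ t ∈ Ico l s, (γ t k).2 = (γ l k).2 := fun t ht =>
    h.vel_eq_of_forall_notMem_Ioc ht.1 (fun τ hτ => hfree τ ⟨hτ.1, hτ.2.trans_lt ht.2⟩) k
  have hev : Continuous fun z : Config N d X => (z k).2 := (continuous_apply k).snd
  have h1 : Tendsto (fun t => (γ t k).2) (𝓝[<] s) (𝓝 (collidePair G p q (γ s) k).2) :=
    (hev.tendsto _).comp (h.tendsto_collidePair hpq hc)
  have h2 : Tendsto (fun t => (γ t k).2) (𝓝[<] s) (𝓝 (γ l k).2) :=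
    tendsto_const_nhds.congr' (by
      filter_upwards [Ico_mem_nhdsLT hls] with t ht
      exact (hlt t ht).symm)
  exact tendsto_nhds_unique h1 h2

/-- **The velocity-jump sum on a fine cell.** If every collision time of a hard-sphere
trajectory (regular geometry) in the cell `(l, r]` equals `s ∈ (l, r]`, the velocity-jump sum
over the cell is the sum of `f (cellMark …)` over the ordered contact pairs at time `s` (an
empty sum if `s` is not a collision time). [folklore] -/
theorem jumpSum_eq {M : Type*} [AddCommMonoid M] (h : IsHardSphereTrajectory G ε N γ)
    (hG : G.IsHardSphereRegular ε)
    (f : ℝ × X × EuclideanSpace ℝ d × EuclideanSpace ℝ d × EuclideanSpace ℝ d → M)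
    {l r s : ℝ} (hs : s ∈ Ioc l r)
    (hsub : ∀ t ∈ collisionTimes G ε γ, t ∈ Ioc l r → t = s) :
    jumpSum G ε γ f l r =
      ∑ p ∈ contactPairs G ε (γ s), f (cellMark G ε γ l r p.1 p.2) := by
  classical
  -- free flight on `(s, r]`
  have hsr : ∀ k, (γ r k).2 = (γ s k).2 := by
    intro k
    refine h.vel_eq_of_forall_notMem_Ioc hs.2 (fun τ hτ hcol => ?_) k
    have := hsub τ hcol ⟨hs.1.trans hτ.1, hτ.2⟩
    linarith [hτ.1]
  by_cases hcol : s ∈ collisionTimes G ε γ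
  · obtain ⟨p, q, hpq, hc⟩ := hcol
    have hpmem : (p, q) ∈ contactPairs G ε (γ s) := mem_contactPairs.2 ⟨hpq, hc⟩
    -- the pre-collisional velocities are the velocities at time `l`
    have hpre : ∀ k, (collidePair G p q (γ s) k).2 = (γ l k).2 :=
      h.collidePair_vel_eq hs.1 (fun τ hτ hcol => by
        have := hsub τ hcol ⟨hτ.1, hτ.2.le.trans hs.2⟩
        linarith [hτ.2]) hpq hc
    have hjump : ∀ k, (γ r k).2 ≠ (γ l k).2 ↔ k = p ∨ k = q := fun k => by
      rw [hsr k, ← hpre k]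
      exact h.vel_ne_collidePair_iff hpq hc k
    rw [jumpSum_def, h.contactPairs_eq_pair hG hpmem]
    have hne : (p, q) ≠ (q, p) := fun hpe => hpq (Prod.mk.inj hpe).1
    rw [← sum_sum_ite_mem_eq (S := {(p, q), (q, p)}) fun i j => f (cellMark G ε γ l r i j)]
    refine Finset.sum_congr rfl fun i _ => Finset.sum_congr rfl fun j _ => ?_
    refine if_congr ?_ rfl rfl
    rw [hjump i, hjump j, Finset.mem_insert, Finset.mem_singleton, Prod.mk.injEq, Prod.mk.injEq]
    constructor
    · rintro ⟨hij, hi | hi, hj | hj⟩ <;> subst hi <;> subst hj <;> tauto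
    · rintro (⟨rfl, rfl⟩ | ⟨rfl, rfl⟩)
      · exact ⟨hpq, Or.inl rfl, Or.inr rfl⟩
      · exact ⟨hpq.symm, Or.inr rfl, Or.inl rfl⟩
  · rw [contactPairs_eq_empty_of_not_mem hcol, Finset.sum_empty]
    refine jumpSum_eq_zero_of_forall_eq fun k => ?_
    rw [hsr k]
    refine h.vel_eq_of_forall_notMem_Ioc hs.1.le (fun τ hτ hc' => ?_) k
    rcases hτ.2.eq_or_lt with rfl | hlt'
    · exact hcol hc'
    · have := hsub τ hc' ⟨hτ.1, hτ.2.trans hs.2⟩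
      linarith

/-! ## Convergence of the dyadic velocity-jump approximation -/

/-- **Marks read off a shrinking cell converge to the collision mark.** Along a hard-sphere
trajectory in a regular geometry, if `(i, j)` is in contact at time `s` and `l_n < s ≤ r_n` are
cells shrinking to `s` whose left parts `(l_n, s)` and right parts `(s, r_n]` are eventually
collision-free, then `cellMark G ε γ l_n r_n i j → (ofConfig G ε (γ s) s i j).mark`: the
velocities at `l_n` ARE the pre-collisional ones, positions are continuous, and the separation
vector is affine along the free flight after `s` (`eventually_sepVec_freeFlight`). [folklore] -/
theorem tendsto_cellMark (h : IsHardSphereTrajectory G ε N γ) (hG : G.IsHardSphereRegular ε)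
    {s : ℝ} {i j : Fin N} (hp : (i, j) ∈ contactPairs G ε (γ s)) {l r : ℕ → ℝ}
    (hl : ∀ n, l n < s) (hr : ∀ n, s ≤ r n) (hr' : Tendsto r atTop (𝓝 s))
    (hfreel : ∀ᶠ n in atTop, ∀ τ ∈ Ioo (l n) s, τ ∉ collisionTimes G ε γ)
    (hfreer : ∀ᶠ n in atTop, ∀ τ ∈ Ioc s (r n), τ ∉ collisionTimes G ε γ) :
    Tendsto (fun n => cellMark G ε γ (l n) (r n) i j) atTop
      (𝓝 (HardSphereCollisionRecord.ofConfig G ε (γ s) s i j).mark) := by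
  obtain ⟨hij, hc⟩ := mem_contactPairs.1 hp
  rw [HardSphereCollisionRecord.mark_def, HardSphereCollisionRecord.ofConfig_preVel_eq_collidePair
    G ε (γ s) s hij]
  simp only [HardSphereCollisionRecord.ofConfig_time, HardSphereCollisionRecord.ofConfig_fstPos,
    HardSphereCollisionRecord.ofConfig_impactVec]
  -- the velocities at `l n` are eventually the pre-collisional ones
  have hvel : ∀ᶠ n in atTop, ∀ k, (γ (l n) k).2 = (collidePair G i j (γ s) k).2 := by
    filter_upwards [hfreel] with n hn k
    exact (h.collidePair_vel_eq (hl n) hn hij hc k).symm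
  -- positions converge
  have hpos : Tendsto (fun n => (γ (r n) i).1) atTop (𝓝 (γ s i).1) :=
    ((h.pos_continuous i).tendsto s).comp hr'
  -- the separation vector along the free flight after `s`
  have hτ : Tendsto (fun n => r n - s) atTop (𝓝 0) := by
    simpa using hr'.sub_const s
  have hlin := hG.eventually_sepVec_freeFlight (z := γ s) (i := i) (j := j)
    (le_of_eq (mem_contactSet.1 hc).2)
  have hdir : Tendsto (fun n => ε⁻¹ • G.sepVec (γ (r n) i).1 (γ (r n) j).1) atTop
      (𝓝 (ε⁻¹ • G.sepVec (γ s i).1 (γ s j).1)) := by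
    have hlim : Tendsto (fun n => ε⁻¹ • (G.sepVec (γ s i).1 (γ s j).1 +
        (r n - s) • ((γ s i).2 - (γ s j).2))) atTop
        (𝓝 (ε⁻¹ • G.sepVec (γ s i).1 (γ s j).1)) := by
      have : Tendsto (fun n => G.sepVec (γ s i).1 (γ s j).1 +
          (r n - s) • ((γ s i).2 - (γ s j).2)) atTop
          (𝓝 (G.sepVec (γ s i).1 (γ s j).1 + (0 : ℝ) • ((γ s i).2 - (γ s j).2))) :=
        tendsto_const_nhds.add (hτ.smul_const _)
      rw [zero_smul, add_zero] at this
      exact this.const_smul ε⁻¹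
    refine hlim.congr' ?_
    filter_upwards [hfreer, hτ.eventually hlin] with n hn hlin_n
    have hflight : γ (r n) = freeFlight G (r n - s) (γ s) := h.free s (r n) (hr n) hn
    rw [hflight, hlin_n]
  -- assemble the five components
  refine Tendsto.congr' ?_ (hr'.prodMk_nhds (hpos.prodMk_nhds (hdir.prodMk_nhds
    (tendsto_const_nhds (x := ((collidePair G i j (γ s) i).2, (collidePair G i j (γ s) j).2))))))
  filter_upwards [hvel] with n hn
  simp only [cellMark, hn i, hn j]

/-- Finitely many times are eventually separated by the dyadic meshes: for large `n` two distinct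
times of a finite set are more than `(b - a)/2^n` apart. [folklore] -/
theorem eventually_fine {T : Set ℝ} (hT : T.Finite) (a b : ℝ) :
    ∀ᶠ n : ℕ in atTop, ∀ s ∈ hT.toFinset, ∀ s' ∈ hT.toFinset, s ≠ s' →
      (b - a) / 2 ^ n < |s - s'| := by
  refine (eventually_all_finset _).2 fun s _ => (eventually_all_finset _).2 fun s' _ => ?_
  by_cases hss' : s = s'
  · exact Eventually.of_forall fun n hne => absurd hss' hne
  · exact ((tendsto_meshSize a b).eventually
      (gt_mem_nhds (abs_pos.2 (sub_ne_zero.2 hss')))).mono fun n hn _ => hn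

omit [TopologicalSpace X] in
/-- A collision time in the `k`-th cell (`k < 2^n`) is a collision time of the window `(a, b]`
with cell index `k`. [folklore] -/
theorem mem_toFinset_of_mem_cell {a b : ℝ} (hab : a < b)
    (hfin : (collisionTimes G ε γ ∩ Ioc a b).Finite) {n k : ℕ} (hk : k < 2 ^ n) {t : ℝ}
    (ht : t ∈ collisionTimes G ε γ) (htk : t ∈ Ioc (meshPt a b n k) (meshPt a b n (k + 1))) :
    t ∈ hfin.toFinset ∧ cellIndex a b n t = k := by
  refine ⟨hfin.mem_toFinset.2 ⟨ht, ?_, ?_⟩, cellIndex_eq_of_mem hab htk⟩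
  · exact (meshPt_mem_Icc hab.le (k := k) hk.le).1.trans_lt htk.1
  · exact htk.2.trans (meshPt_mem_Icc hab.le (k := k + 1) hk).2

/-- **The velocity-jump sum of one cell of a fine mesh** is the sum, over the collision times of
the window with that cell index (at most one), of `f (cellMark …)` over their contact pairs.
[folklore] -/
theorem jumpSum_cell_eq {M : Type*} [AddCommMonoid M] (h : IsHardSphereTrajectory G ε N γ)
    (hG : G.IsHardSphereRegular ε) {a b : ℝ} (hab : a < b)
    (f : ℝ × X × EuclideanSpace ℝ d × EuclideanSpace ℝ d × EuclideanSpace ℝ d → M)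
    (hfin : (collisionTimes G ε γ ∩ Ioc a b).Finite) {n : ℕ}
    (hfine : ∀ s ∈ hfin.toFinset, ∀ s' ∈ hfin.toFinset, s ≠ s' →
      (b - a) / 2 ^ n < |s - s'|) {k : ℕ} (hk : k < 2 ^ n) :
    jumpSum G ε γ f (meshPt a b n k) (meshPt a b n (k + 1)) =
      ∑ s ∈ hfin.toFinset with cellIndex a b n s = k, ∑ p ∈ contactPairs G ε (γ s),
        f (cellMark G ε γ (meshPt a b n k) (meshPt a b n (k + 1)) p.1 p.2) := by
  have hmesh : 0 < (b - a) / 2 ^ n := div_pos (sub_pos.2 hab) (by positivity)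
  have hcell : meshPt a b n k < meshPt a b n (k + 1) := by rw [meshPt_succ]; linarith
  rcases (hfin.toFinset.filter fun s => cellIndex a b n s = k).eq_empty_or_nonempty with
    he | ⟨s₀, hs₀⟩
  · rw [he, Finset.sum_empty]
    have hno : ∀ t ∈ collisionTimes G ε γ,
        t ∉ Ioc (meshPt a b n k) (meshPt a b n (k + 1)) := by
      intro t ht htk
      obtain ⟨hT, hidx⟩ := mem_toFinset_of_mem_cell hab hfin hk ht htk
      have : t ∈ hfin.toFinset.filter fun s => cellIndex a b n s = k :=
        Finset.mem_filter.2 ⟨hT, hidx⟩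
      rw [he] at this
      exact Finset.notMem_empty t this
    rw [h.jumpSum_eq hG f (s := meshPt a b n (k + 1)) ⟨hcell, le_rfl⟩
      (fun t ht htk => absurd htk (hno t ht)), contactPairs_eq_empty_of_not_mem
      (fun hc => hno _ hc ⟨hcell, le_rfl⟩), Finset.sum_empty]
  · obtain ⟨hs₀T, hidx₀⟩ := Finset.mem_filter.1 hs₀
    have hs₀cell : s₀ ∈ Ioc (meshPt a b n k) (meshPt a b n (k + 1)) := by
      have := (mem_cell_cellIndex hab n (hfin.mem_toFinset.1 hs₀T).2).2
      rwa [hidx₀] at this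
    -- by fineness `s₀` is the only collision time of the window in this cell
    have huniq : ∀ t ∈ collisionTimes G ε γ,
        t ∈ Ioc (meshPt a b n k) (meshPt a b n (k + 1)) → t = s₀ := by
      intro t ht htk
      by_contra hne
      have hT := (mem_toFinset_of_mem_cell hab hfin hk ht htk).1
      exact (lt_irrefl _) ((hfine t hT s₀ hs₀T hne).trans (sub_lt_of_mem_cell htk hs₀cell))
    have hfilter : (hfin.toFinset.filter fun s => cellIndex a b n s = k) = {s₀} := by
      refine Finset.eq_singleton_iff_unique_mem.2 ⟨hs₀, fun t ht => ?_⟩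
      obtain ⟨htT, hidx⟩ := Finset.mem_filter.1 ht
      have htcell : t ∈ Ioc (meshPt a b n k) (meshPt a b n (k + 1)) := by
        have := (mem_cell_cellIndex hab n (hfin.mem_toFinset.1 htT).2).2
        rwa [hidx] at this
      exact huniq t (hfin.mem_toFinset.1 htT).1 htcell
    rw [hfilter, Finset.sum_singleton]
    exact h.jumpSum_eq hG f hs₀cell huniq

/-- **Convergence of the dyadic velocity-jump approximation.** Along a hard-sphere trajectory in a
regular geometry, for every continuous `f` the rank-`n` velocity-jump approximation over `(a, b]`
converges to the collision sum `Σ_{collisions in (a, b]} Σ_{ordered contact pairs} f (mark)` as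
`n → ∞` (finitely many collisions, each eventually alone in its cell; `jumpSum_cell_eq`,
`tendsto_cellMark`). [folklore] -/
theorem tendsto_collisionSumApprox {E : Type*} [AddCommMonoid E] [TopologicalSpace E]
    [ContinuousAdd E] (h : IsHardSphereTrajectory G ε N γ) (hG : G.IsHardSphereRegular ε)
    {a b : ℝ} (hab : a < b)
    {f : ℝ × X × EuclideanSpace ℝ d × EuclideanSpace ℝ d × EuclideanSpace ℝ d → E}
    (hf : Continuous f) :
    Tendsto (fun n => collisionSumApprox G ε γ f a b n) atTop
      (𝓝 (collisionSum G ε γ (Ioc a b) fun c => f c.mark)) := by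
  have hfin : (collisionTimes G ε γ ∩ Ioc a b).Finite :=
    h.finite_collisionTimes_inter_of_subset_Icc Ioc_subset_Icc_self
  rw [collisionSum_eq_finset_sum hfin]
  have hfine := eventually_fine hfin a b
  -- the approximants, rewritten as sums over the collision times
  have happrox : ∀ᶠ n in atTop, (∑ s ∈ hfin.toFinset, ∑ p ∈ contactPairs G ε (γ s),
      f (cellMark G ε γ (meshPt a b n (cellIndex a b n s)) (meshPt a b n (cellIndex a b n s + 1))
        p.1 p.2)) = collisionSumApprox G ε γ f a b n := by
    filter_upwards [hfine] with n hn
    have hmaps : ∀ s ∈ hfin.toFinset, cellIndex a b n s ∈ Finset.range (2 ^ n) := fun s hs =>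
      Finset.mem_range.2 (mem_cell_cellIndex hab n (hfin.mem_toFinset.1 hs).2).1
    symm
    calc collisionSumApprox G ε γ f a b n
        = ∑ k ∈ Finset.range (2 ^ n), ∑ s ∈ hfin.toFinset with cellIndex a b n s = k,
            ∑ p ∈ contactPairs G ε (γ s),
              f (cellMark G ε γ (meshPt a b n k) (meshPt a b n (k + 1)) p.1 p.2) :=
          Finset.sum_congr rfl fun k hk =>
            h.jumpSum_cell_eq hG hab f hfin hn (Finset.mem_range.1 hk)
      _ = ∑ k ∈ Finset.range (2 ^ n), ∑ s ∈ hfin.toFinset with cellIndex a b n s = k,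
            ∑ p ∈ contactPairs G ε (γ s),
              f (cellMark G ε γ (meshPt a b n (cellIndex a b n s))
                (meshPt a b n (cellIndex a b n s + 1)) p.1 p.2) :=
          Finset.sum_congr rfl fun k _ => Finset.sum_congr rfl fun s hs => by
            rw [(Finset.mem_filter.1 hs).2]
      _ = _ := Finset.sum_fiberwise_of_maps_to hmaps _
  refine Tendsto.congr' happrox (tendsto_finsetSum _ fun s hs => tendsto_finsetSum _ fun p hp => ?_)
  -- convergence of each term
  obtain ⟨hsC, hsI⟩ := hfin.mem_toFinset.1 hs
  have hcell := fun n => (mem_cell_cellIndex hab n hsI).2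
  have hmesh : ∀ n, meshPt a b n (cellIndex a b n s + 1) =
      meshPt a b n (cellIndex a b n s) + (b - a) / 2 ^ n := fun n => meshPt_succ a b n _
  have hr' : Tendsto (fun n => meshPt a b n (cellIndex a b n s + 1)) atTop (𝓝 s) := by
    refine tendsto_of_tendsto_of_tendsto_of_le_of_le tendsto_const_nhds
      (by simpa using (tendsto_meshSize a b).const_add s) (fun n => (hcell n).2) fun n => ?_
    have := (hcell n).1
    rw [hmesh n]
    linarith
  -- in a fine mesh the rest of the cell of `s` is collision-free
  have hfree : ∀ᶠ n in atTop, ∀ τ ∈ collisionTimes G ε γ,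
      τ ∈ Ioc (meshPt a b n (cellIndex a b n s)) (meshPt a b n (cellIndex a b n s + 1)) →
        τ = s := by
    filter_upwards [hfine] with n hn τ hτ hτcell
    by_contra hne
    have hidx := (mem_cell_cellIndex hab n hsI).1
    have hT := (mem_toFinset_of_mem_cell hab hfin hidx hτ hτcell).1
    exact (lt_irrefl _) ((hn τ hT s hs hne).trans (sub_lt_of_mem_cell hτcell (hcell n)))
  obtain ⟨i, j⟩ := p
  refine (hf.tendsto _).comp (h.tendsto_cellMark hG hp (fun n => (hcell n).1) (fun n => (hcell n).2)
    hr' ?_ ?_)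
  · filter_upwards [hfree] with n hn τ hτ hτC
    have := hn τ hτC ⟨hτ.1, hτ.2.le.trans (hcell n).2⟩
    linarith [hτ.2]
  · filter_upwards [hfree] with n hn τ hτ hτC
    have := hn τ hτC ⟨(hcell n).1.trans hτ.1, hτ.2⟩
    linarith [hτ.1]

end IsHardSphereTrajectory

/-! ## The collision at the left endpoint of a closed window -/

section Singleton

variable {G : Geometry d X} {ε : ℝ} {γ : ℝ → Config N d X}

/-- The collision pair sum over a single time `a` is the contact-pair sum at `a` (empty unless
`a` is a collision time). [folklore] -/
theorem collisionPairSum_singleton {M : Type*} [AddCommMonoid M] (a : ℝ)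
    (g : ℝ → Fin N → Fin N → M) :
    collisionPairSum G ε γ {a} g = ∑ p ∈ contactPairs G ε (γ a), g a p.1 p.2 := by
  by_cases ha : a ∈ collisionTimes G ε γ
  · rw [collisionPairSum, inter_eq_self_of_subset_right (singleton_subset_iff.2 ha),
      finsum_mem_singleton]
  · rw [collisionPairSum_eq_zero_of_forall_not_mem (S := {a}) (fun t ht => by
      rwa [mem_singleton_iff.1 ht]), contactPairs_eq_empty_of_not_mem ha, Finset.sum_empty]

/-- On a hard-sphere trajectory the collision pair sum over `[a, b]` (`a ≤ b`) splits into the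
collision at `a` (if any) and the sum over `(a, b]`. [folklore] -/
theorem IsHardSphereTrajectory.collisionPairSum_Icc {M : Type*} [AddCommMonoid M]
    [TopologicalSpace X] (h : IsHardSphereTrajectory G ε N γ) {a b : ℝ} (hab : a ≤ b)
    (g : ℝ → Fin N → Fin N → M) :
    collisionPairSum G ε γ (Icc a b) g =
      (∑ p ∈ contactPairs G ε (γ a), g a p.1 p.2) + collisionPairSum G ε γ (Ioc a b) g := by
  have hdisj : Disjoint (Ioc a b) {a} := disjoint_singleton_right.2 fun ha => lt_irrefl a ha.1
  rw [← collisionPairSum_singleton, ← Ioc_union_left hab, collisionPairSum_union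
    (h.finite_collisionTimes_inter_of_subset_Icc Ioc_subset_Icc_self)
    (h.finite_collisionTimes_inter_of_subset_Icc (singleton_subset_iff.2 (left_mem_Icc.2 hab)))
    hdisj, add_comm]

end Singleton

/-! ## Measurability in the initial datum along a hard-sphere flow -/

section Reflect

variable {E' : Type*} [NormedAddCommGroup E'] [InnerProductSpace ℝ E'] [MeasurableSpace E']
  [BorelSpace E'] [SecondCountableTopology E']

/-- The elastic reflection law is jointly measurable in the impact direction and the velocities
(local copy of `BBGKYMarginalsProofs`'s `measurable_reflectVel`, not imported here). [folklore] -/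
private theorem measurable_reflectVel_prod :
    Measurable fun q : E' × (E' × E') => reflectVel q.1 q.2 := by
  have hc : Measurable fun q : E' × (E' × E') => ⟪q.2.1 - q.2.2, q.1⟫_ℝ / ‖q.1‖ ^ 2 :=
    ((measurable_snd.fst.sub measurable_snd.snd).inner measurable_fst).div
      (measurable_fst.norm.pow_const 2)
  unfold reflectVel
  exact (measurable_snd.fst.sub (hc.smul measurable_fst)).prodMk
    (measurable_snd.snd.add (hc.smul measurable_fst))

end Reflect

namespace HardSphereFlow

variable [MeasureSpace X] [TopologicalSpace X] {G : Geometry d X} {ε : ℝ}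
  (Φ : HardSphereFlow G ε N)

/-- The cell mark read off the orbit of `z` is measurable in `z` (point evaluations of the flow
at the two fixed times `l, r` only). [folklore] -/
theorem measurable_cellMark (hGm : G.IsMeasurable) (l r : ℝ) (i j : Fin N) :
    Measurable fun z => cellMark G ε (fun t => Φ.flow t z) l r i j := by
  have hx : Measurable fun z : Config N d X => (Φ.flow r z i).1 :=
    (Geometry.IsMeasurable.measurable_pos i).comp (Φ.measurable_flow r)
  have hn : Measurable fun z : Config N d X =>
      ε⁻¹ • G.sepVec (Φ.flow r z i).1 (Φ.flow r z j).1 :=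
    ((hGm.measurable_sepVec_config i j).comp (Φ.measurable_flow r)).const_smul ε⁻¹
  have hv : ∀ k : Fin N, Measurable fun z : Config N d X => (Φ.flow l z k).2 := fun k =>
    (Geometry.IsMeasurable.measurable_vel k).comp (Φ.measurable_flow l)
  show Measurable fun z => (r, (Φ.flow r z i).1,
    ε⁻¹ • G.sepVec (Φ.flow r z i).1 (Φ.flow r z j).1, (Φ.flow l z i).2, (Φ.flow l z j).2)
  exact measurable_const.prodMk (hx.prodMk (hn.prodMk ((hv i).prodMk (hv j))))

variable {E : Type*} [AddCommMonoid E] [MeasurableSpace E]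

/-- The velocity-jump sum over a fixed cell, read off the orbit of `z`, is measurable in `z`.
[folklore] -/
theorem measurable_jumpSum [MeasurableAdd₂ E] (hGm : G.IsMeasurable)
    {f : ℝ × X × EuclideanSpace ℝ d × EuclideanSpace ℝ d × EuclideanSpace ℝ d → E}
    (hf : Measurable f) (l r : ℝ) :
    Measurable fun z => jumpSum G ε (fun t => Φ.flow t z) f l r := by
  unfold jumpSum
  refine Finset.measurable_sum _ fun i _ => Finset.measurable_sum _ fun j _ => ?_
  have hv : ∀ (t : ℝ) (k : Fin N), Measurable fun z : Config N d X => (Φ.flow t z k).2 :=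
    fun t k => (Geometry.IsMeasurable.measurable_vel k).comp (Φ.measurable_flow t)
  refine Measurable.ite ?_ (hf.comp (Φ.measurable_cellMark hGm l r i j)) measurable_const
  exact (MeasurableSet.const _).inter (((measurableSet_eq_fun (hv r i) (hv l i)).compl).inter
    (measurableSet_eq_fun (hv r j) (hv l j)).compl)

/-- The rank-`n` velocity-jump approximation, read off the orbit of `z`, is measurable in `z`.
[folklore] -/
theorem measurable_collisionSumApprox [MeasurableAdd₂ E] (hGm : G.IsMeasurable)
    {f : ℝ × X × EuclideanSpace ℝ d × EuclideanSpace ℝ d × EuclideanSpace ℝ d → E}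
    (hf : Measurable f) (a b : ℝ) (n : ℕ) :
    Measurable fun z => collisionSumApprox G ε (fun t => Φ.flow t z) f a b n :=
  Finset.measurable_sum _ fun _ _ => Φ.measurable_jumpSum hGm hf _ _

/-- **Measurability of collision sums over `(a, b]` in the initial datum.** Along a hard-sphere
flow in a regular measurable geometry, for every continuous and measurable `f`, the collision sum
`z ↦ Σ_{collisions of the orbit of z in (a, b]} Σ_{ordered contact pairs} f (mark)`, extended by
`0` off the good set, is measurable: on the good set it is the pointwise limit of the measurable
velocity-jump approximations (`tendsto_collisionSumApprox`). Only the time-slice measurability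
`Φ.measurable_flow` is used (no joint measurability of `(t, z) ↦ Φ_t z`). [folklore] -/
theorem measurable_indicator_collisionSum_Ioc [TopologicalSpace E] [ContinuousAdd E]
    [TopologicalSpace.PseudoMetrizableSpace E] [BorelSpace E] [MeasurableAdd₂ E]
    (hG : G.IsHardSphereRegular ε) (hGm : G.IsMeasurable)
    {f : ℝ × X × EuclideanSpace ℝ d × EuclideanSpace ℝ d × EuclideanSpace ℝ d → E}
    (hfc : Continuous f) (hfm : Measurable f) (a b : ℝ) :
    Measurable (Φ.good.indicator fun z => Φ.collisionSum (Ioc a b) (fun c => f c.mark) z) := by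
  by_cases hab : a < b
  · refine measurable_of_tendsto_metrizable (f := fun n => Φ.good.indicator fun z =>
      collisionSumApprox G ε (fun t => Φ.flow t z) f a b n)
      (fun n => (Φ.measurable_collisionSumApprox hGm hfm a b n).indicator Φ.measurableSet_good) ?_
    rw [tendsto_pi_nhds]
    intro z
    by_cases hz : z ∈ Φ.good
    · simp only [indicator_of_mem hz]
      exact (Φ.isTrajectory z hz).tendsto_collisionSumApprox hG hab hfc
    · simp only [indicator_of_notMem hz]
      exact tendsto_const_nhds
  · have h0 : (fun z => Φ.collisionSum (Ioc a b) (fun c => f c.mark) z) = fun _ => 0 := by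
      funext z
      rw [HardSphereFlow.collisionSum_eq, Ioc_eq_empty hab,
        FluidPDE.collisionSum_eq_collisionPairSum, FluidPDE.collisionPairSum_empty]
    rw [h0]
    exact measurable_const.indicator Φ.measurableSet_good

/-- The collision term at a fixed time `a`, read off the orbit, is measurable in the datum.
[folklore] -/
theorem measurable_sum_contactPairs [MeasurableAdd₂ E] (hGm : G.IsMeasurable)
    {f : ℝ × X × EuclideanSpace ℝ d × EuclideanSpace ℝ d × EuclideanSpace ℝ d → E}
    (hfm : Measurable f) (a : ℝ) :
    Measurable fun z => ∑ p ∈ contactPairs G ε (Φ.flow a z),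
      f (HardSphereCollisionRecord.ofConfig G ε (Φ.flow a z) a p.1 p.2).mark := by
  classical
  have hrw : ∀ z : Config N d X, (∑ p ∈ contactPairs G ε (Φ.flow a z),
      f (HardSphereCollisionRecord.ofConfig G ε (Φ.flow a z) a p.1 p.2).mark) =
      ∑ p : Fin N × Fin N, if p.1 ≠ p.2 ∧ Φ.flow a z ∈ contactSet G N ε p.1 p.2 then
        f (HardSphereCollisionRecord.ofConfig G ε (Φ.flow a z) a p.1 p.2).mark else 0 := by
    intro z
    rw [contactPairs, Finset.sum_filter]
  simp_rw [hrw]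
  refine Finset.measurable_sum _ fun p _ => Measurable.ite ?_ ?_ measurable_const
  · exact (MeasurableSet.const _).inter
      ((measurableSet_contactSet G hGm.measurable_sepVec N ε p.1 p.2).preimage
        (Φ.measurable_flow a))
  · refine hfm.comp ?_
    simp only [HardSphereCollisionRecord.mark_def, HardSphereCollisionRecord.ofConfig_time,
      HardSphereCollisionRecord.ofConfig_fstPos, HardSphereCollisionRecord.ofConfig_impactVec,
      HardSphereCollisionRecord.ofConfig_preVel]
    have hx : Measurable fun z : Config N d X => (Φ.flow a z p.1).1 :=
      (Geometry.IsMeasurable.measurable_pos p.1).comp (Φ.measurable_flow a)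
    have hn : Measurable fun z : Config N d X => G.sepVec (Φ.flow a z p.1).1 (Φ.flow a z p.2).1 :=
      (hGm.measurable_sepVec_config p.1 p.2).comp (Φ.measurable_flow a)
    have hv : ∀ k : Fin N, Measurable fun z : Config N d X => (Φ.flow a z k).2 :=
      fun k => (Geometry.IsMeasurable.measurable_vel k).comp (Φ.measurable_flow a)
    have hrefl : Measurable fun z : Config N d X =>
        reflectVel (G.sepVec (Φ.flow a z p.1).1 (Φ.flow a z p.2).1)
          ((Φ.flow a z p.1).2, (Φ.flow a z p.2).2) :=
      measurable_reflectVel_prod.comp (hn.prodMk ((hv p.1).prodMk (hv p.2)))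
    exact measurable_const.prodMk (hx.prodMk ((hn.const_smul ε⁻¹).prodMk
      (hrefl.fst.prodMk hrefl.snd)))

/-- **Measurability of collision sums over `[a, b]` in the initial datum** (the window of route
statements, `Icc 0 τ`): as `measurable_indicator_collisionSum_Ioc`, plus the (measurable)
contribution of a collision at time `a`. [folklore] -/
theorem measurable_indicator_collisionSum_Icc [TopologicalSpace E] [ContinuousAdd E]
    [TopologicalSpace.PseudoMetrizableSpace E] [BorelSpace E] [MeasurableAdd₂ E]
    (hG : G.IsHardSphereRegular ε) (hGm : G.IsMeasurable)
    {f : ℝ × X × EuclideanSpace ℝ d × EuclideanSpace ℝ d × EuclideanSpace ℝ d → E}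
    (hfc : Continuous f) (hfm : Measurable f) (a b : ℝ) :
    Measurable (Φ.good.indicator fun z => Φ.collisionSum (Icc a b) (fun c => f c.mark) z) := by
  by_cases hab : a ≤ b
  · have hsplit : (Φ.good.indicator fun z => Φ.collisionSum (Icc a b) (fun c => f c.mark) z) =
        (Φ.good.indicator fun z => ∑ p ∈ contactPairs G ε (Φ.flow a z),
          f (HardSphereCollisionRecord.ofConfig G ε (Φ.flow a z) a p.1 p.2).mark) +
        Φ.good.indicator fun z => Φ.collisionSum (Ioc a b) (fun c => f c.mark) z := by
      rw [← indicator_add']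
      refine indicator_congr fun z hz => ?_
      simp only [Pi.add_apply, HardSphereFlow.collisionSum_eq,
        FluidPDE.collisionSum_eq_collisionPairSum]
      exact (Φ.isTrajectory z hz).collisionPairSum_Icc hab _
    rw [hsplit]
    exact ((Φ.measurable_sum_contactPairs hGm hfm a).indicator Φ.measurableSet_good).add
      (Φ.measurable_indicator_collisionSum_Ioc hG hGm hfc hfm a b)
  · have h0 : (fun z => Φ.collisionSum (Icc a b) (fun c => f c.mark) z) = fun _ => 0 := by
      funext z
      rw [HardSphereFlow.collisionSum_eq, Icc_eq_empty hab,
        FluidPDE.collisionSum_eq_collisionPairSum, FluidPDE.collisionPairSum_empty]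
    rw [h0]
    exact measurable_const.indicator Φ.measurableSet_good

/-- **Measurability of `z ↦ ∫ f dκ_z` for the empirical collision measure over `[a, b]`**, the
integral extended by `0` off the good set: for continuous (and measurable) real `f`, along a
hard-sphere flow in a regular measurable geometry with measurable singletons (`ℝ^d`, `T^d`).
[folklore] -/
theorem measurable_indicator_integral_empiricalCollisionMeasure [MeasurableSingletonClass X]
    (hG : G.IsHardSphereRegular ε) (hGm : G.IsMeasurable)
    {f : ℝ × X × EuclideanSpace ℝ d × EuclideanSpace ℝ d × EuclideanSpace ℝ d → ℝ}
    (hfc : Continuous f) (hfm : Measurable f) (a b : ℝ) :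
    Measurable (Φ.good.indicator fun z =>
      ∫ m, f m ∂Φ.empiricalCollisionMeasure (Icc a b) z) := by
  have heq : (Φ.good.indicator fun z => ∫ m, f m ∂Φ.empiricalCollisionMeasure (Icc a b) z) =
      Φ.good.indicator fun z => Φ.collisionSum (Icc a b) (fun c => f c.mark) z :=
    indicator_congr fun z hz => Φ.integral_empiricalCollisionMeasure hz Subset.rfl f
  rw [heq]
  exact Φ.measurable_indicator_collisionSum_Icc hG hGm hfc hfm a b

/-- The same over the half-open window `(a, b]`. [folklore] -/
theorem measurable_indicator_integral_empiricalCollisionMeasure_Ioc [MeasurableSingletonClass X]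
    (hG : G.IsHardSphereRegular ε) (hGm : G.IsMeasurable)
    {f : ℝ × X × EuclideanSpace ℝ d × EuclideanSpace ℝ d × EuclideanSpace ℝ d → ℝ}
    (hfc : Continuous f) (hfm : Measurable f) (a b : ℝ) :
    Measurable (Φ.good.indicator fun z =>
      ∫ m, f m ∂Φ.empiricalCollisionMeasure (Ioc a b) z) := by
  have heq : (Φ.good.indicator fun z => ∫ m, f m ∂Φ.empiricalCollisionMeasure (Ioc a b) z) =
      Φ.good.indicator fun z => Φ.collisionSum (Ioc a b) (fun c => f c.mark) z :=
    indicator_congr fun z hz => Φ.integral_empiricalCollisionMeasure hz Ioc_subset_Icc_self f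
  rw [heq]
  exact Φ.measurable_indicator_collisionSum_Ioc hG hGm hfc hfm a b

/-- **Almost-everywhere measurability of `z ↦ ∫ f dκ_z`** under any law carried by the good set
(e.g. the Liouville measure, `Φ.measure_compl_good`, or any law absolutely continuous with
respect to it). [folklore] -/
theorem aemeasurable_integral_empiricalCollisionMeasure [MeasurableSingletonClass X]
    (hG : G.IsHardSphereRegular ε) (hGm : G.IsMeasurable)
    {f : ℝ × X × EuclideanSpace ℝ d × EuclideanSpace ℝ d × EuclideanSpace ℝ d → ℝ}
    (hfc : Continuous f) (hfm : Measurable f) (a b : ℝ) {μ : Measure (Config N d X)}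
    (hμ : μ Φ.goodᶜ = 0) :
    AEMeasurable (fun z => ∫ m, f m ∂Φ.empiricalCollisionMeasure (Icc a b) z) μ := by
  refine ⟨_, Φ.measurable_indicator_integral_empiricalCollisionMeasure hG hGm hfc hfm a b, ?_⟩
  have hae : ∀ᵐ z ∂μ, z ∈ Φ.good := by
    rw [ae_iff]
    exact hμ
  filter_upwards [hae] with z hz
  exact (indicator_of_mem hz fun z => ∫ m, f m ∂Φ.empiricalCollisionMeasure (Icc a b) z).symm

end HardSphereFlow

end Kinetic

end

end Literature.Analysis.FluidPDE
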